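import Summits.CriticalPhenomena.PercolationContinuityZ3.Theorems.PercNearOneGluingNoHeavyLowerTailThreePartitionVOrder

/-!
# CONJECTURE W — the kernel form of Conjecture V: the three-partition kernel stays up-set-nonnegative when the
# product weight `[a ∈ 𝒱][b ∈ 𝒲]` is replaced by ANY nonnegative, monotone, 2-increasing bivariate weight `Z(a,b)`

Support file (lineage `prim-bnk-2`, generation 33; `--supports stmt-CriticalPhenomena-4575`; memo
`run/shared/lean/prim/prim-l12/FROM-prim-bnk-2-g33-CONJ-W.md`).  No `sorry`, standard axioms; the only unproved statement is
the `@[conjecture]`-tagged `VOrderKernelPositivity`, used as an explicit hypothesis.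

Conjecture V (`VOrderPositivity`, file `…ThreePartitionVOrder`) says that for up-sets `𝒱, 𝒲`, a twist `τ` and an up-set `𝒳`
of the copy order, `vSumT τ 𝒱 𝒲 𝒳 = Σ_{(a,b)∈𝒳} K_{𝒱,𝒲}(a,b,c) ≥ 0` with
`K_{𝒱,𝒲}(a,b,c) = 2[a∈𝒱][a∈𝒲] + [c∈𝒱][b∈𝒲] − [c∈𝒱][a∈𝒲] − [a∈𝒱][c∈𝒲] − [c∈𝒱][c∈𝒲]`.
The kernel is BILINEAR in the pair of indicators, `K = 2Z(a,a) + Z(c,b) − Z(c,a) − Z(a,c) − Z(c,c)` with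
`Z(S,T) = [S∈𝒱][T∈𝒲]` (`vSumT_eq_vSumTZ`).  Such a `Z` is nonnegative, monotone in each argument and 2-INCREASING
(`Z(S',T) + Z(S,T') ≤ Z(S',T') + Z(S,T)` for `S ⊆ S'`, `T ⊆ T'`; `indicatorZ_two_increasing`).
**Conjecture W** (`VOrderKernelPositivity`, this work, OPEN) asks the same inequality for EVERY weight `Z` of this class
(`vSumTZ τ Z 𝒳 ≥ 0`).  By LP duality it says that, for each fixed up-set `𝒳`, the `2^ι × 2^ι` coefficient matrix
`M_𝒳[S,T]` of the bilinear form `(1_𝒱, 1_𝒲) ↦ vSumT τ 𝒱 𝒲 𝒳` lies in the cone generated by the tensor products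
`r ⊗ r'` of point masses and up-dipoles `δ_{S∪{i}} − δ_S` — a statement in which `𝒱` and `𝒲` NO LONGER APPEAR.  Census
(memo §1; HiGHS LPs, kit jobs j245605/j245795/j245796): every up-set of the face poset for `m ≤ 3` (15 936 at `m = 3`,
all twists), `m = 4`: 31 651 up-sets incl. all cylinders and all principal up-sets (5 twist classes), `m = 5`: 20 472 up-sets
incl. all principal ones (6 twist classes) — no failure.  PROVED CASES (memo §3): the up-set of all faces, and every principal
up-set (untwisted; companion file `…ThreePartitionVOrderPrincipal`, THEOREM P).
Consequences proved here: `vOrderPositivity_of_vOrderKernelPositivity`, hence Sahi's `C₃` on product measures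
(`masterFamilyNonneg_three_of_vOrderKernelPositivity`). [this work]
-/

noncomputable section

open Finset
open scoped symmDiff Classical

namespace Summit.CriticalPhenomena.PercolationContinuityZ3.Theorems.ThreePartition

variable {ι : Type*} [Fintype ι]

/-! ## Faces, the kernel of a bivariate weight, the weighted sum -/

/-- The faces (untwisted first two parts `(S₁,S₂)`, disjoint; `S₃ = (S₁ ∪ S₂)ᶜ`) whose pair of copies
`(S₁ ∆ τ, S₂ ∆ τ)` lies in `𝒳`. [this work] -/
def facesIn (τ : Set ι) (𝒳 : Set (Set ι × Set ι)) : Finset (Set ι × Set ι) :=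
  univ.filter fun q : Set ι × Set ι => Disjoint q.1 q.2 ∧ (q.1 ∆ τ, q.2 ∆ τ) ∈ 𝒳

/-- The kernel of a bivariate weight `Z` at a face: `2Z(a,a) + Z(c,b) − Z(c,a) − Z(a,c) − Z(c,c)`
(copies `a = S₁ ∆ τ`, `b = S₂ ∆ τ`, `c = (S₁ ∪ S₂)ᶜ ∆ τ`). [this work] -/
def kerZ (τ : Set ι) (Z : Set ι → Set ι → ℤ) (q : Set ι × Set ι) : ℤ :=
  2 * Z (q.1 ∆ τ) (q.1 ∆ τ) + Z ((q.1 ∪ q.2)ᶜ ∆ τ) (q.2 ∆ τ) - Z ((q.1 ∪ q.2)ᶜ ∆ τ) (q.1 ∆ τ)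
    - Z (q.1 ∆ τ) ((q.1 ∪ q.2)ᶜ ∆ τ) - Z ((q.1 ∪ q.2)ᶜ ∆ τ) ((q.1 ∪ q.2)ᶜ ∆ τ)

/-- **The weighted kernel sum** `Σ_{(a,b) ∈ 𝒳} (2Z(a,a) + Z(c,b) − Z(c,a) − Z(a,c) − Z(c,c))`. [this work] -/
def vSumTZ (τ : Set ι) (Z : Set ι → Set ι → ℤ) (𝒳 : Set (Set ι × Set ι)) : ℤ :=
  ∑ q ∈ facesIn τ 𝒳, kerZ τ Z q

/-- **CONJECTURE W** (this work; OPEN): for every finite ground set, every twist `τ`, every weight `Z` that is nonnegative,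
monotone in each argument and 2-INCREASING (`Z(S',T) + Z(S,T') ≤ Z(S',T') + Z(S,T)` for `S ⊆ S'`, `T ⊆ T'`) — the dual cone of
the tensor products `r ⊗ r'` of point masses and up-dipoles — and every up-set `𝒳` of the copy order, the weighted kernel sum
`vSumTZ τ Z 𝒳` is `≥ 0`.  For `Z(S,T) = [S∈𝒱][T∈𝒲]` this is Conjecture V (`vOrderPositivity_of_vOrderKernelPositivity`); by LP
duality it is the `𝒱,𝒲`-free statement "the coefficient matrix of `vSumT τ · · 𝒳` lies in the cone of tensor products of point
masses and up-dipoles".  Census: all up-sets of the face poset for `m ≤ 3` and all twists; `m = 4`: 31 651 up-sets (all cylinders,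
all principal up-sets, samples; 5 twist classes); `m = 5`: 20 472 up-sets (6 twist classes); `0` failures (memo
`FROM-prim-bnk-2-g33-CONJ-W.md`).  Proved for principal up-sets (untwisted): `…ThreePartitionVOrderPrincipal`.  An obligation of
our theories, never a fact: use as `(h : VOrderKernelPositivity)`. [status: open] -/
@[conjecture] def VOrderKernelPositivity : Prop :=
  ∀ (ι : Type) [Fintype ι] (τ : Set ι) (Z : Set ι → Set ι → ℤ) (𝒳 : Set (Set ι × Set ι)),
    (∀ S T, 0 ≤ Z S T) →
    (∀ (S S' T : Set ι), S ⊆ S' → Z S T ≤ Z S' T) →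
    (∀ (S T T' : Set ι), T ⊆ T' → Z S T ≤ Z S T') →
    (∀ (S S' T T' : Set ι), S ⊆ S' → T ⊆ T' → Z S' T + Z S T' ≤ Z S' T' + Z S T) →
    IsUpperSet 𝒳 → 0 ≤ vSumTZ τ Z 𝒳

/-! ## The product weight of two up-sets -/

/-- The product weight `[S ∈ 𝒱][T ∈ 𝒲]`. [this work] -/
def indicatorZ (𝒱 𝒲 : Set (Set ι)) : Set ι → Set ι → ℤ := fun S T => if S ∈ 𝒱 ∧ T ∈ 𝒲 then 1 else 0

omit [Fintype ι] in
/-- The product weight is `0/1`-valued. [this work] -/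
theorem indicatorZ_eq_ite (𝒱 𝒲 : Set (Set ι)) (S T : Set ι) :
    indicatorZ 𝒱 𝒲 S T = if S ∈ 𝒱 ∧ T ∈ 𝒲 then 1 else 0 := rfl

omit [Fintype ι] in
/-- The product weight is nonnegative. [this work] -/
theorem indicatorZ_nonneg (𝒱 𝒲 : Set (Set ι)) (S T : Set ι) : 0 ≤ indicatorZ 𝒱 𝒲 S T := by
  rw [indicatorZ_eq_ite]; split_ifs <;> norm_num

omit [Fintype ι] in
/-- The product weight of two up-sets is monotone in the first argument. [this work] -/
theorem indicatorZ_mono_left {𝒱 : Set (Set ι)} (𝒲 : Set (Set ι)) (h𝒱 : IsUpperSet 𝒱) (S S' T : Set ι)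
    (hS : S ⊆ S') : indicatorZ 𝒱 𝒲 S T ≤ indicatorZ 𝒱 𝒲 S' T := by
  rw [indicatorZ_eq_ite, indicatorZ_eq_ite]
  by_cases h1 : S ∈ 𝒱 ∧ T ∈ 𝒲
  · rw [if_pos h1, if_pos (show S' ∈ 𝒱 ∧ T ∈ 𝒲 from ⟨h𝒱 hS h1.1, h1.2⟩)]
  · rw [if_neg h1]; split_ifs <;> norm_num

omit [Fintype ι] in
/-- The product weight of two up-sets is monotone in the second argument. [this work] -/
theorem indicatorZ_mono_right (𝒱 : Set (Set ι)) {𝒲 : Set (Set ι)} (h𝒲 : IsUpperSet 𝒲) (S T T' : Set ι)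
    (hT : T ⊆ T') : indicatorZ 𝒱 𝒲 S T ≤ indicatorZ 𝒱 𝒲 S T' := by
  rw [indicatorZ_eq_ite, indicatorZ_eq_ite]
  by_cases h1 : S ∈ 𝒱 ∧ T ∈ 𝒲
  · rw [if_pos h1, if_pos (show S ∈ 𝒱 ∧ T' ∈ 𝒲 from ⟨h1.1, h𝒲 hT h1.2⟩)]
  · rw [if_neg h1]; split_ifs <;> norm_num

omit [Fintype ι] in
/-- The product weight of two up-sets is 2-increasing. [this work] -/
theorem indicatorZ_two_increasing {𝒱 𝒲 : Set (Set ι)} (h𝒱 : IsUpperSet 𝒱) (h𝒲 : IsUpperSet 𝒲)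
    (S S' T T' : Set ι) (hS : S ⊆ S') (hT : T ⊆ T') :
    indicatorZ 𝒱 𝒲 S' T + indicatorZ 𝒱 𝒲 S T' ≤ indicatorZ 𝒱 𝒲 S' T' + indicatorZ 𝒱 𝒲 S T := by
  simp only [indicatorZ_eq_ite]
  by_cases hS' : S' ∈ 𝒱
  · by_cases hT' : T' ∈ 𝒲
    · rw [if_pos (show S' ∈ 𝒱 ∧ T' ∈ 𝒲 from ⟨hS', hT'⟩)]
      by_cases hSv : S ∈ 𝒱
      · by_cases hTw : T ∈ 𝒲
        · rw [if_pos (show S' ∈ 𝒱 ∧ T ∈ 𝒲 from ⟨hS', hTw⟩), if_pos (show S ∈ 𝒱 ∧ T' ∈ 𝒲 from ⟨hSv, hT'⟩),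
            if_pos (show S ∈ 𝒱 ∧ T ∈ 𝒲 from ⟨hSv, hTw⟩)]
        · rw [if_neg (show ¬(S' ∈ 𝒱 ∧ T ∈ 𝒲) from fun h => hTw h.2),
            if_pos (show S ∈ 𝒱 ∧ T' ∈ 𝒲 from ⟨hSv, hT'⟩), if_neg (show ¬(S ∈ 𝒱 ∧ T ∈ 𝒲) from fun h => hTw h.2)]
          norm_num
      · rw [if_neg (show ¬(S ∈ 𝒱 ∧ T' ∈ 𝒲) from fun h => hSv h.1),
          if_neg (show ¬(S ∈ 𝒱 ∧ T ∈ 𝒲) from fun h => hSv h.1)]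
        split_ifs <;> norm_num
    · have hTw : T ∉ 𝒲 := fun h => hT' (h𝒲 hT h)
      rw [if_neg (show ¬(S' ∈ 𝒱 ∧ T ∈ 𝒲) from fun h => hTw h.2), if_neg (show ¬(S ∈ 𝒱 ∧ T' ∈ 𝒲) from fun h => hT' h.2),
        if_neg (show ¬(S' ∈ 𝒱 ∧ T' ∈ 𝒲) from fun h => hT' h.2), if_neg (show ¬(S ∈ 𝒱 ∧ T ∈ 𝒲) from fun h => hTw h.2)]
  · have hSv : S ∉ 𝒱 := fun h => hS' (h𝒱 hS h)
    rw [if_neg (show ¬(S' ∈ 𝒱 ∧ T ∈ 𝒲) from fun h => hS' h.1), if_neg (show ¬(S ∈ 𝒱 ∧ T' ∈ 𝒲) from fun h => hSv h.1),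
      if_neg (show ¬(S' ∈ 𝒱 ∧ T' ∈ 𝒲) from fun h => hS' h.1), if_neg (show ¬(S ∈ 𝒱 ∧ T ∈ 𝒲) from fun h => hSv h.1)]

/-! ## `vSumT` is the weighted sum of the product weight -/

/-- A twisted count whose predicate starts with `(a,b) ∈ 𝒳`, as a sum of an indicator over `facesIn τ 𝒳`. [this work] -/
theorem triT_mem_and_eq_sum (τ : Set ι) (𝒳 : Set (Set ι × Set ι)) (p : Set ι → Set ι → Set ι → Prop) :
    (triT τ (fun a b c => (a, b) ∈ 𝒳 ∧ p a b c) : ℤ) =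
      ∑ q ∈ facesIn τ 𝒳, (if p (q.1 ∆ τ) (q.2 ∆ τ) ((q.1 ∪ q.2)ᶜ ∆ τ) then (1 : ℤ) else 0) := by
  have hc : triT τ (fun a b c => (a, b) ∈ 𝒳 ∧ p a b c) =
      #((facesIn τ 𝒳).filter fun q => p (q.1 ∆ τ) (q.2 ∆ τ) ((q.1 ∪ q.2)ᶜ ∆ τ)) := by
    unfold triT tri facesIn
    congr 1
    ext q
    simp only [mem_filter, mem_univ, true_and, and_assoc]
  rw [hc, Finset.card_eq_sum_ones, Finset.sum_filter]
  push_cast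
  rfl

/-- **`vSumT τ 𝒱 𝒲 𝒳 = vSumTZ τ ([·∈𝒱][·∈𝒲]) 𝒳`**: Conjecture V is the product-weight case of Conjecture W. [this work] -/
theorem vSumT_eq_vSumTZ (τ : Set ι) (𝒱 𝒲 : Set (Set ι)) (𝒳 : Set (Set ι × Set ι)) :
    vSumT τ 𝒱 𝒲 𝒳 = vSumTZ τ (indicatorZ 𝒱 𝒲) 𝒳 := by
  unfold vSumT vSumTZ kerZ indicatorZ
  have h1 := triT_mem_and_eq_sum τ 𝒳 (fun a _ _ => a ∈ 𝒱 ∧ a ∈ 𝒲)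
  have h2 := triT_mem_and_eq_sum τ 𝒳 (fun _ b c => c ∈ 𝒱 ∧ b ∈ 𝒲)
  have h3 := triT_mem_and_eq_sum τ 𝒳 (fun a _ c => a ∈ 𝒲 ∧ c ∈ 𝒱)
  have h4 := triT_mem_and_eq_sum τ 𝒳 (fun a _ c => a ∈ 𝒱 ∧ c ∈ 𝒲)
  have h5 := triT_mem_and_eq_sum τ 𝒳 (fun _ _ c => c ∈ 𝒱 ∧ c ∈ 𝒲)
  push_cast
  rw [h1, h2, h3, h4, h5, Finset.mul_sum, ← Finset.sum_add_distrib, ← Finset.sum_add_distrib,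
    ← Finset.sum_add_distrib, ← Finset.sum_sub_distrib]
  refine Finset.sum_congr rfl fun q _ => ?_
  generalize (q.1 ∪ q.2)ᶜ ∆ τ = c
  generalize q.1 ∆ τ = a
  generalize q.2 ∆ τ = b
  by_cases h1 : a ∈ 𝒱 <;> by_cases h2 : a ∈ 𝒲 <;> by_cases h3 : b ∈ 𝒲 <;> by_cases h4 : c ∈ 𝒱 <;>
    by_cases h5 : c ∈ 𝒲 <;> simp [h1, h2, h3, h4, h5]

/-! ## The bridge -/

/-- **Conjecture W ⟹ Conjecture V.** [this work] -/
theorem vOrderPositivity_of_vOrderKernelPositivity (h : VOrderKernelPositivity) : VOrderPositivity := by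
  intro ι _ τ 𝒱 𝒲 𝒳 h𝒱 h𝒲 h𝒳
  rw [vSumT_eq_vSumTZ]
  exact h ι τ (indicatorZ 𝒱 𝒲) 𝒳 (indicatorZ_nonneg 𝒱 𝒲) (indicatorZ_mono_left 𝒲 h𝒱)
    (indicatorZ_mono_right 𝒱 h𝒲) (indicatorZ_two_increasing h𝒱 h𝒲) h𝒳

/-- **Conjecture W ⟹ Sahi's `C₃` on every product measure** (`MasterFamilyNonneg 3`). [this work] -/
theorem masterFamilyNonneg_three_of_vOrderKernelPositivity (h : VOrderKernelPositivity) : MasterFamilyNonneg 3 :=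
  masterFamilyNonneg_three_of_vOrderPositivity (vOrderPositivity_of_vOrderKernelPositivity h)

end Summit.CriticalPhenomena.PercolationContinuityZ3.Theorems.ThreePartition
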